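import Literature.Analysis.Quadrature.EulerMaclaurinTrapezoidal
import Literature.Analysis.Quadrature.ConvexBracketing
import Literature.Analysis.Quadrature.MidpointTrapezoidPeanoKernel

/-!
# Ventures/CertifiedManyBodySolver — Conjectures/MidpointEulerMaclaurin.lean: the EULER–MACLAURIN EXPANSION OF THE COMPOUND MIDPOINT RULE
(the quadrature engine of **T-M1D.49 Lemma 2**), DERIVED FROM THE TREE

HONEST FRAMING: first certified bounds; not a superconductivity verdict; every number certified or labelled float.

Source: `HOME/sr-mbsolver-m1-4/structure/design/BLINDNESS-ASYMPTOTICS.md` (T-M1D.49; sr-mbsolver-m1-4 gen 18, 2026-08-25), §2 Lemma 2 and §6.7 (rev. 2).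

WHY. In T-M1D.49 both shell parities of the certified one-body window are one node lattice and the cap sums are COMPOSITE-MIDPOINT sums
(Lemma 1); the blindness expansion `B_n(ν) = (π sin πν/6) n⁻² − (π/3) sin(πf) n⁻³ + …` (Theorem 1) is the Euler–Maclaurin expansion of those
midpoint sums with the midpoint Bernoulli constants `b_j = B_{2j}(½)/(2j)! = −(1 − 2^{1−2j}) B_{2j}/(2j)!` (`b₁ = −1/24`, `b₂ = 7/5760`, …).
The tree already holds the Euler–Maclaurin expansion of Mathlib's compound TRAPEZOIDAL rule with its periodic-Bernoulli remainder
(`Literature.Analysis.Quadrature.trapezoidal_integral_eq_eulerMaclaurin`, Davis–Rabinowitz (2.9.15)) and the identity `T_{2n} = ½(T_n + M_n)`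
(`Literature.Analysis.Quadrature.trapezoidal_integral_two_mul`).  This file combines them: `M_n = 2 T_{2n} − T_n`, hence the expansion below,
with an explicit remainder to which the tree's bound `abs_bernoulliPer_odd_div_factorial_le` ((2.9.17)) applies term by term.

WHAT IS TYPED AND PROVED HERE (real-variable statements only; nothing about the Hubbard chain is asserted):
* `midpointRule_eq_two_mul_trapezoidal_sub` — `M_n(f) = 2 T_{2n}(f) − T_n(f)` for the tree's `midpointRule` and Mathlib's `trapezoidal_integral`;
* `abs_midpointRule_sub_eulerMaclaurin_le` (rev. 2) — the EXPLICIT REMAINDER BOUND: for `k ≥ 1`, `|g^{(2k+1)}| ≤ M` on `[a, b]`, `n ≥ 1`,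
  `|M_n(g₀) − (∫ₐᵇ g₀ − Σ_{j≤k} …)| ≤ (1 + 2^{−2k}) · M (b − a)^{2k+2} ζ(2k+1) / (2^{2k} π^{2k+1} n^{2k+1})`, `ζ(2k+1) = Σ' i, 1/i^{2k+1}`,
  from the tree's `abs_bernoulliFun_odd_le_tsum` ((2.9.17)) — the midpoint analogue of `abs_integral_sub_trapezoidal_le_of_odd_derivs_eq` WITHOUT the
  odd-derivative hypothesis (the Bernoulli-number sum is kept on the left); this is the effective statement an explicit-constant version of
  T-M1D.49 Theorem 1 needs (§6.6 of the source).
* `midpointRule_eq_eulerMaclaurin` — for a finite derivative family `g : ℕ → ℝ → ℝ` of class `C^{2k+1}[a, b]` (`a ≤ b`, `0 < n`, `h = (b − a)/n`):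
  `M_n(g₀) = ∫ₐᵇ g₀ − Σ_{j=1}^{k} (1 − 2/2^{2j}) (B_{2j}/(2j)!) h^{2j} [g^{(2j−1)}(b) − g^{(2j−1)}(a)]`
  `        + (h^{2k+1}/(2k+1)!) · ( (2/2^{2k+1}) ∫ₐᵇ P_{2k+1}(2n(x−a)/(b−a)) g^{(2k+1)} − ∫ₐᵇ P_{2k+1}(n(x−a)/(b−a)) g^{(2k+1)} )`,
  `P_l =` the tree's periodic Bernoulli function `bernoulliPer l`.
-/

namespace Summit.Ventures.CertifiedManyBodySolver.Conjectures.MidpointEulerMaclaurin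

open Real Set MeasureTheory intervalIntegral Finset
open Literature.Analysis.Quadrature Literature.NumberTheory.LFunctions
open scoped Interval

/-- `M_n = 2 T_{2n} − T_n` (from the tree's `trapezoidal_integral_two_mul`). -/
theorem midpointRule_eq_two_mul_trapezoidal_sub (f : ℝ → ℝ) (n : ℕ) (a b : ℝ) :
    midpointRule f n a b = 2 * trapezoidal_integral f (2 * n) a b - trapezoidal_integral f n a b := by
  have h := trapezoidal_integral_two_mul f n a b
  unfold midpointRule
  linarith

/-- **Euler–Maclaurin expansion of the compound midpoint rule** with the periodic-Bernoulli remainder, for a finite derivative family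
`g j = g₀^{(j)}`, `j ≤ 2k+1`, on `[a, b]`. -/
theorem midpointRule_eq_eulerMaclaurin {g : ℕ → ℝ → ℝ} {a b : ℝ} (hab : a ≤ b) {k : ℕ}
    (hg : ∀ j ≤ 2 * k, ∀ x ∈ Icc a b, HasDerivAt (g j) (g (j + 1) x) x)
    (hgc : ContinuousOn (g (2 * k + 1)) (Icc a b)) {n : ℕ} (hn : 0 < n) :
    midpointRule (g 0) n a b = (∫ x in a..b, g 0 x) -
      ∑ j ∈ Finset.Icc 1 k, (1 - 2 / 2 ^ (2 * j)) * ((bernoulli (2 * j) : ℝ) / (2 * j).factorial) *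
        ((b - a) / n) ^ (2 * j) * (g (2 * j - 1) b - g (2 * j - 1) a) +
      ((b - a) / n) ^ (2 * k + 1) / (2 * k + 1).factorial *
        (2 / 2 ^ (2 * k + 1) * (∫ x in a..b, bernoulliPer (2 * k + 1) (2 * n * (x - a) / (b - a)) * g (2 * k + 1) x) -
          ∫ x in a..b, bernoulliPer (2 * k + 1) (n * (x - a) / (b - a)) * g (2 * k + 1) x) := by
  have h2n : 0 < 2 * n := by omega
  have hn' : (n : ℝ) ≠ 0 := by exact_mod_cast hn.ne'
  have h1 := trapezoidal_integral_eq_eulerMaclaurin hab hg hgc hn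
  have h2 := trapezoidal_integral_eq_eulerMaclaurin hab hg hgc h2n
  simp only [Nat.cast_mul, Nat.cast_ofNat] at h2
  -- the two Bernoulli sums combine termwise: 2 (h/2)^{2j} − h^{2j} = −(1 − 2/2^{2j}) h^{2j}
  have hS : 2 * ∑ j ∈ Finset.Icc 1 k, (bernoulli (2 * j) : ℝ) / (2 * j).factorial *
        ((b - a) / (2 * (n : ℝ))) ^ (2 * j) * (g (2 * j - 1) b - g (2 * j - 1) a) -
      ∑ j ∈ Finset.Icc 1 k, (bernoulli (2 * j) : ℝ) / (2 * j).factorial *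
        ((b - a) / n) ^ (2 * j) * (g (2 * j - 1) b - g (2 * j - 1) a) =
      -∑ j ∈ Finset.Icc 1 k, (1 - 2 / 2 ^ (2 * j)) * ((bernoulli (2 * j) : ℝ) / (2 * j).factorial) *
        ((b - a) / n) ^ (2 * j) * (g (2 * j - 1) b - g (2 * j - 1) a) := by
    rw [Finset.mul_sum, ← Finset.sum_sub_distrib, ← Finset.sum_neg_distrib]
    refine Finset.sum_congr rfl fun j _ => ?_
    have h2j : (2 : ℝ) ^ (2 * j) ≠ 0 := by positivity
    rw [div_pow, div_pow, mul_pow]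
    field_simp
    ring
  -- the remainder: 2 (h/2)^{2k+1} = h^{2k+1} · 2/2^{2k+1}
  have hR : 2 * (((b - a) / (2 * (n : ℝ))) ^ (2 * k + 1) / (2 * k + 1).factorial *
        ∫ x in a..b, bernoulliPer (2 * k + 1) (2 * n * (x - a) / (b - a)) * g (2 * k + 1) x) =
      ((b - a) / n) ^ (2 * k + 1) / (2 * k + 1).factorial * (2 / 2 ^ (2 * k + 1) *
        ∫ x in a..b, bernoulliPer (2 * k + 1) (2 * n * (x - a) / (b - a)) * g (2 * k + 1) x) := by
    have h2k : (2 : ℝ) ^ (2 * k + 1) ≠ 0 := by positivity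
    have hF : ((2 * k + 1).factorial : ℝ) ≠ 0 := by positivity
    rw [div_pow, div_pow, mul_pow]
    field_simp
  rw [midpointRule_eq_two_mul_trapezoidal_sub, h1, h2]
  linear_combination hS + hR


/-- **Explicit remainder bound for the midpoint Euler–Maclaurin expansion.** -/
theorem abs_midpointRule_sub_eulerMaclaurin_le {g : ℕ → ℝ → ℝ} {a b : ℝ} (hab : a ≤ b) {k : ℕ} (hk : k ≠ 0)
    (hg : ∀ j ≤ 2 * k, ∀ x ∈ Icc a b, HasDerivAt (g j) (g (j + 1) x) x)
    (hgc : ContinuousOn (g (2 * k + 1)) (Icc a b))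
    {M : ℝ} (hM : ∀ x ∈ Icc a b, |g (2 * k + 1) x| ≤ M) {n : ℕ} (hn : 0 < n) :
    |midpointRule (g 0) n a b - ((∫ x in a..b, g 0 x) -
      ∑ j ∈ Finset.Icc 1 k, (1 - 2 / 2 ^ (2 * j)) * ((bernoulli (2 * j) : ℝ) / (2 * j).factorial) *
        ((b - a) / n) ^ (2 * j) * (g (2 * j - 1) b - g (2 * j - 1) a))| ≤
      (1 + 1 / 2 ^ (2 * k)) * (M * (b - a) ^ (2 * k + 2) * (∑' i : ℕ, 1 / (i : ℝ) ^ (2 * k + 1)) /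
        (2 ^ (2 * k) * π ^ (2 * k + 1)) / n ^ (2 * k + 1)) := by
  set Z : ℝ := ∑' i : ℕ, 1 / (i : ℝ) ^ (2 * k + 1) with hZ
  have hZ0 : 0 ≤ Z := tsum_nonneg fun i => by positivity
  have hn' : (0 : ℝ) < n := Nat.cast_pos.mpr hn
  have hfac : (0 : ℝ) < (2 * k + 1).factorial := by exact_mod_cast Nat.factorial_pos _
  have hM0 : 0 ≤ M := (abs_nonneg _).trans (hM a (left_mem_Icc.mpr hab))
  rw [midpointRule_eq_eulerMaclaurin hab hg hgc hn, add_sub_cancel_left]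
  -- the two remainder integrands and their common sup bound
  set C : ℝ := 2 * ((2 * k + 1).factorial : ℝ) / (2 * π) ^ (2 * k + 1) * Z * M with hC
  have hC0 : 0 ≤ C := by positivity
  have hP : ∀ t : ℝ, |bernoulliPer (2 * k + 1) t| ≤ 2 * ((2 * k + 1).factorial : ℝ) / (2 * π) ^ (2 * k + 1) * Z := by
    intro t
    rw [bernoulliPer_def]
    exact abs_bernoulliFun_odd_le_tsum hk ⟨Int.fract_nonneg _, (Int.fract_lt_one _).le⟩
  have hK : ∀ c : ℝ, ∀ x ∈ Ι a b, ‖bernoulliPer (2 * k + 1) (c * (x - a) / (b - a)) * g (2 * k + 1) x‖ ≤ C := by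
    intro c x hx
    rw [uIoc_of_le hab] at hx
    rw [Real.norm_eq_abs, abs_mul, hC]
    exact mul_le_mul (hP _) (hM x ⟨hx.1.le, hx.2⟩) (abs_nonneg _) (by positivity)
  have hI1 := intervalIntegral.norm_integral_le_of_norm_le_const (hK (n : ℝ))
  have hI2 := intervalIntegral.norm_integral_le_of_norm_le_const (hK (2 * (n : ℝ)))
  rw [Real.norm_eq_abs, abs_of_nonneg (sub_nonneg.2 hab)] at hI1 hI2
  -- |h^{2k+1}/(2k+1)! · (c I₂ − I₁)| ≤ h^{2k+1}/(2k+1)! · (c + 1) · C (b − a)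
  have hh0 : 0 ≤ ((b - a) / n) ^ (2 * k + 1) / (2 * k + 1).factorial := by
    have : 0 ≤ (b - a) / n := div_nonneg (sub_nonneg.2 hab) hn'.le
    positivity
  have hc0 : (0 : ℝ) ≤ 2 / 2 ^ (2 * k + 1) := by positivity
  rw [abs_mul, abs_of_nonneg hh0]
  have hin : |2 / 2 ^ (2 * k + 1) * (∫ x in a..b, bernoulliPer (2 * k + 1) (2 * n * (x - a) / (b - a)) * g (2 * k + 1) x) -
      ∫ x in a..b, bernoulliPer (2 * k + 1) (n * (x - a) / (b - a)) * g (2 * k + 1) x| ≤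
      (2 / 2 ^ (2 * k + 1) + 1) * (C * (b - a)) := by
    refine (abs_sub _ _).trans ?_
    rw [abs_mul, abs_of_nonneg hc0, add_mul, one_mul]
    exact add_le_add (mul_le_mul_of_nonneg_left hI2 hc0) hI1
  calc ((b - a) / n) ^ (2 * k + 1) / (2 * k + 1).factorial *
        |2 / 2 ^ (2 * k + 1) * (∫ x in a..b, bernoulliPer (2 * k + 1) (2 * n * (x - a) / (b - a)) * g (2 * k + 1) x) -
          ∫ x in a..b, bernoulliPer (2 * k + 1) (n * (x - a) / (b - a)) * g (2 * k + 1) x|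
      ≤ ((b - a) / n) ^ (2 * k + 1) / (2 * k + 1).factorial * ((2 / 2 ^ (2 * k + 1) + 1) * (C * (b - a))) :=
        mul_le_mul_of_nonneg_left hin hh0
    _ = (1 + 1 / 2 ^ (2 * k)) * (M * (b - a) ^ (2 * k + 2) * Z / (2 ^ (2 * k) * π ^ (2 * k + 1)) / n ^ (2 * k + 1)) := by
        rw [hC, mul_pow, div_pow, pow_succ (2 : ℝ) (2 * k), pow_succ (b - a) (2 * k + 1)]
        field_simp
        ring

end Summit.Ventures.CertifiedManyBodySolver.Conjectures.MidpointEulerMaclaurin
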